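import Summits.Ventures.HodgeRepro2.T5SU11ResolventNeumannSeries

/-!
# The resolvent is differentiable in the spectral parameter, with derivative the square of the resolvent

On the weighted space `|g(s)| ≤ N e^{−εs}` (`2 − λ₂ < ε < λ₂`), the Neumann series of row 507 gives:

* **a bound of `G^I_λ` uniform on the disc** `|μ − μ₂| c₂ < 1` (`abs_greenSolI_le_of_disc`):
  `|G^I_λ h(t)| ≤ (c₂/(1 − |μ − μ₂| c₂)) N′ e^{−εt}` — the constant depends on `λ` only through `|μ − μ₂|`;
* with the finite expansion of row 503 at order one, `G^I_λ g(t) = G^I_{λ₂} g(t) + (μ − μ₂) h₂(t) + (μ − μ₂)² G^I_λ h₂(t)`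
  (`h₂ = (G^I_{λ₂})² g`), whose last term is `O((λ − λ₂)²)` near `λ₂`, hence

**`λ ↦ G^I_λ g(t)` is differentiable at `λ₂` with derivative `(2λ₂ − 2) · (G^I_{λ₂})² g(t)`**
(`hasDerivAt_greenSolI_lam`) — the classical `d/dμ (L − μ)⁻¹ = (L − μ)⁻²` for the radial Laplacian of the explicit
model, read through `μ = λ(λ − 2)`, `dμ/dλ = 2λ − 2`; in particular the resolvent is continuous in `λ`
(`continuousAt_greenSolI_lam`). Nothing is claimed about (N).

Blind lane: Mathlib + the HodgeRepro2 prefix only; no sorry; axioms ⊆ {propext, Classical.choice,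
Quot.sound}.
-/

namespace Summit.Ventures.HodgeRepro2.T5SU11ResolventAnalytic

open Filter Topology MeasureTheory
open Set (Ioi Ioc)
open T5SU11Cartan T5SU11SphericalFunction T5SU11SphericalDecay T5SU11RadialGreenImproper
  T5SU11ResolventNeumann T5SU11ResolventWeightedBasis T5SU11ResolventWeightedBound
  T5SU11ResolventNeumannSeries

/-- `μ(λ) − μ(λ₂) = (λ − λ₂)(λ + λ₂ − 2)`. -/
theorem mu_sub_eq (lam lam₂ : ℝ) :
    lam * (lam - 2) - lam₂ * (lam₂ - 2) = (lam - lam₂) * (lam + lam₂ - 2) := by ring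

/-- `λ ↦ λ(λ − 2)` is continuous. -/
theorem tendsto_mu (lam₂ : ℝ) :
    Tendsto (fun lam : ℝ => lam * (lam - 2)) (𝓝 lam₂) (𝓝 (lam₂ * (lam₂ - 2))) :=
  ((continuous_id.mul (continuous_id.sub continuous_const)).tendsto lam₂)

section measure

variable [MeasurableSpace Circle] [BorelSpace Circle]

variable {lam lam₂ ε : ℝ} (hlam : 1 < lam) (hlam₂ : 1 < lam₂) (hε₁ : 2 - lam < ε) (hε₂ : 2 - lam₂ < ε)
  (hε₃ : ε < lam) (hε₄ : ε < lam₂)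
  {c₂ : ℝ} (hc₂ : 0 ≤ c₂)
  (hbound : ∀ (h : ℝ → ℝ) (N' : ℝ), ContinuousOn h (Ioi 0) → 0 ≤ N' →
    (∀ s, 0 < s → |h s| ≤ N' * Real.exp (-ε * s)) →
    ∀ t, 0 < t → |greenSolI (fun t => sph lam₂ (hyp t)) (sphDecay lam₂) h t| ≤ c₂ * N' * Real.exp (-ε * t))

include hlam hlam₂ hε₁ hε₂ hε₃ hc₂ hbound in
/-- **The weighted bound of `G^I_λ` is uniform on the disc `|μ − μ₂| c₂ < 1`**:
`|G^I_λ h(t)| ≤ (c₂/(1 − |μ − μ₂| c₂)) N′ e^{−εt}`. -/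
theorem abs_greenSolI_le_of_disc (hq : |lam * (lam - 2) - lam₂ * (lam₂ - 2)| * c₂ < 1)
    {h : ℝ → ℝ} (hh : ContinuousOn h (Ioi 0)) {N' : ℝ} (hN'0 : 0 ≤ N')
    (hN' : ∀ s, 0 < s → |h s| ≤ N' * Real.exp (-ε * s)) {t : ℝ} (ht : 0 < t) :
    |greenSolI (fun t => sph lam (hyp t)) (sphDecay lam) h t|
      ≤ c₂ / (1 - |lam * (lam - 2) - lam₂ * (lam₂ - 2)| * c₂) * N' * Real.exp (-ε * t) := by
  have hq0 : 0 ≤ |lam * (lam - 2) - lam₂ * (lam₂ - 2)| * c₂ := by positivity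
  have hS := hasSum_neumann_series hlam hlam₂ hε₁ hε₂ hε₃ hh hN'0 hN' hc₂ hbound hq ht
  have hgeom : HasSum (fun k : ℕ => c₂ * N' * Real.exp (-ε * t) * (|lam * (lam - 2) - lam₂ * (lam₂ - 2)| * c₂) ^ k)
      (c₂ * N' * Real.exp (-ε * t) * (1 - |lam * (lam - 2) - lam₂ * (lam₂ - 2)| * c₂)⁻¹) :=
    (hasSum_geometric_of_lt_one hq0 hq).mul_left _
  have hb := tsum_of_norm_bounded hgeom (fun k => by
    rw [Real.norm_eq_abs]
    exact abs_neumann_term_le (lam := lam) hlam₂ hε₂ hh hN'0 hN' hc₂ hbound (g := h) k ht)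
  rw [hS.tsum_eq, Real.norm_eq_abs] at hb
  calc |greenSolI (fun t => sph lam (hyp t)) (sphDecay lam) h t|
      ≤ c₂ * N' * Real.exp (-ε * t) * (1 - |lam * (lam - 2) - lam₂ * (lam₂ - 2)| * c₂)⁻¹ := hb
    _ = c₂ / (1 - |lam * (lam - 2) - lam₂ * (lam₂ - 2)| * c₂) * N' * Real.exp (-ε * t) := by ring

end measure

section derivative

variable [MeasurableSpace Circle] [BorelSpace Circle]

variable {lam₂ ε : ℝ} (hlam₂ : 1 < lam₂) (hε₂ : 2 - lam₂ < ε) (hε₄ : ε < lam₂)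
  {g : ℝ → ℝ} (hg : ContinuousOn g (Ioi 0)) {N : ℝ} (hN0 : 0 ≤ N)
  (hN : ∀ s, 0 < s → |g s| ≤ N * Real.exp (-ε * s))

include hlam₂ hε₂ hε₄ hg hN0 hN in
/-- **THE RESOLVENT IS DIFFERENTIABLE IN THE SPECTRAL PARAMETER**: `λ ↦ G^I_λ g(t)` has derivative
`(2λ₂ − 2) · G^I_{λ₂}(G^I_{λ₂} g)(t)` at `λ₂` — `d/dμ (L − μ)⁻¹ = (L − μ)⁻²` through `μ = λ(λ − 2)`. -/
theorem hasDerivAt_greenSolI_lam {t : ℝ} (ht : 0 < t) :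
    HasDerivAt (fun lam => greenSolI (fun t => sph lam (hyp t)) (sphDecay lam) g t)
      ((2 * lam₂ - 2) * greenSolI (fun t => sph lam₂ (hyp t)) (sphDecay lam₂)
        (greenSolI (fun t => sph lam₂ (hyp t)) (sphDecay lam₂) g) t) lam₂ := by
  obtain ⟨c₂, hc₂, hbound⟩ := exists_abs_greenSolI_le_weighted hlam₂ hε₂ hε₄
  set G₂ := greenSolI (fun t => sph lam₂ (hyp t)) (sphDecay lam₂) with hG₂
  set h₂ := G₂ (G₂ g) with hh₂
  -- `h₂ = (G^I_{λ₂})² g` is in the weighted space with constant `c₂² N`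
  obtain ⟨hh₂cont, hh₂b⟩ := iterate_weighted hlam₂ hε₂ hg hN0 hN hc₂ hbound 2
  have hit : (G₂)^[2] g = h₂ := rfl
  rw [hit] at hh₂cont hh₂b
  have hM := abs_le_of_weighted hN
  have hC := abs_le_exp_of_weighted hN
  -- the remainder `R(λ) = G^I_λ h₂(t)` and its uniform bound on the half-disc `|μ − μ₂| c₂ ≤ 1/2`
  set K := c₂ / (1 - 1 / 2) * (c₂ ^ 2 * N) * Real.exp (-ε * t) with hK
  have hK0 : 0 ≤ K := by positivity
  -- the eventual facts near `λ₂`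
  have hev : ∀ᶠ lam in 𝓝 lam₂, 1 < lam ∧ 2 - lam < ε ∧ ε < lam ∧
      |lam * (lam - 2) - lam₂ * (lam₂ - 2)| * c₂ ≤ 1 / 2 := by
    have h1 : ∀ᶠ lam in 𝓝 lam₂, 1 < lam := eventually_gt_nhds hlam₂
    have h2 : ∀ᶠ lam in 𝓝 lam₂, 2 - ε < lam := eventually_gt_nhds (by linarith)
    have h3 : ∀ᶠ lam in 𝓝 lam₂, ε < lam := eventually_gt_nhds hε₄
    have h4 : ∀ᶠ lam in 𝓝 lam₂, |lam * (lam - 2) - lam₂ * (lam₂ - 2)| * c₂ ≤ 1 / 2 := by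
      rcases eq_or_lt_of_le hc₂ with hc0 | hc0
      · exact Eventually.of_forall fun lam => by rw [← hc0, mul_zero]; norm_num
      · have := (tendsto_mu lam₂).eventually (eventually_abs_sub_lt (lam₂ * (lam₂ - 2))
          (by positivity : (0 : ℝ) < 1 / (2 * c₂)))
        filter_upwards [this] with lam hlam
        have h := mul_lt_mul_of_pos_right hlam hc0
        have e : 1 / (2 * c₂) * c₂ = 1 / 2 := by field_simp
        linarith
    filter_upwards [h1, h2, h3, h4] with lam h1 h2 h3 h4
    exact ⟨h1, by linarith, h3, h4⟩
  rw [hasDerivAt_iff_tendsto_slope]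
  -- the slope is `(λ + λ₂ − 2) h₂(t) + (λ − λ₂)(λ + λ₂ − 2)² R(λ)` near `λ₂`
  have hslope : slope (fun lam => greenSolI (fun t => sph lam (hyp t)) (sphDecay lam) g t) lam₂
      =ᶠ[𝓝[≠] lam₂] fun lam => (lam + lam₂ - 2) * h₂ t
        + (lam - lam₂) * (lam + lam₂ - 2) ^ 2
          * greenSolI (fun t => sph lam (hyp t)) (sphDecay lam) h₂ t := by
    filter_upwards [self_mem_nhdsWithin, nhdsWithin_le_nhds hev] with lam hne hlam
    obtain ⟨hlam1, hlam2, _, _⟩ := hlam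
    have hne' : lam - lam₂ ≠ 0 := sub_ne_zero.mpr hne
    rw [slope_def_field]
    have hfin := neumann_finite hlam1 hlam₂ hg hM (by positivity) hlam2 hε₂ hC 1 ht
    simp only [Finset.sum_range_succ, Finset.sum_range_zero, pow_zero, one_mul, zero_add, pow_one,
      Function.iterate_one] at hfin
    rw [show (greenSolI (fun t => sph lam₂ (hyp t)) (sphDecay lam₂))^[1 + 1] g = h₂ from rfl] at hfin
    rw [hfin, mu_sub_eq]
    field_simp
    ring
  refine (Tendsto.congr' hslope.symm ?_)
  -- the two pieces
  have hA : Tendsto (fun lam : ℝ => (lam + lam₂ - 2) * h₂ t) (𝓝[≠] lam₂) (𝓝 ((2 * lam₂ - 2) * h₂ t)) := by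
    have : Tendsto (fun lam : ℝ => (lam + lam₂ - 2) * h₂ t) (𝓝 lam₂) (𝓝 ((lam₂ + lam₂ - 2) * h₂ t)) :=
      ((continuous_id.add continuous_const).sub continuous_const).mul continuous_const |>.tendsto lam₂
    rw [show lam₂ + lam₂ - 2 = 2 * lam₂ - 2 by ring] at this
    exact this.mono_left nhdsWithin_le_nhds
  have hB : Tendsto (fun lam : ℝ => (lam - lam₂) * (lam + lam₂ - 2) ^ 2
      * greenSolI (fun t => sph lam (hyp t)) (sphDecay lam) h₂ t) (𝓝[≠] lam₂) (𝓝 0) := by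
    -- squeeze against `|λ − λ₂| (λ + λ₂ − 2)² K → 0`
    have hlim : Tendsto (fun lam : ℝ => |lam - lam₂| * (lam + lam₂ - 2) ^ 2 * K) (𝓝 lam₂) (𝓝 0) := by
      have : Tendsto (fun lam : ℝ => |lam - lam₂| * (lam + lam₂ - 2) ^ 2 * K) (𝓝 lam₂)
          (𝓝 (|lam₂ - lam₂| * (lam₂ + lam₂ - 2) ^ 2 * K)) :=
        (((continuous_id.sub continuous_const).abs.mul
          (((continuous_id.add continuous_const).sub continuous_const).pow 2)).mul continuous_const).tendsto lam₂
      simpa using this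
    refine squeeze_zero_norm' ?_ (hlim.mono_left nhdsWithin_le_nhds)
    filter_upwards [nhdsWithin_le_nhds hev] with lam hlam
    obtain ⟨hlam1, hlam2, hlam3, hq⟩ := hlam
    have hq' : |lam * (lam - 2) - lam₂ * (lam₂ - 2)| * c₂ < 1 := lt_of_le_of_lt hq (by norm_num)
    have hR := abs_greenSolI_le_of_disc hlam1 hlam₂ hlam2 hε₂ hlam3 hc₂ hbound hq' hh₂cont
      (by positivity : 0 ≤ c₂ ^ 2 * N) hh₂b ht
    have hRK : |greenSolI (fun t => sph lam (hyp t)) (sphDecay lam) h₂ t| ≤ K := by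
      refine le_trans hR ?_
      rw [hK]
      have hden : 1 - 1 / 2 ≤ 1 - |lam * (lam - 2) - lam₂ * (lam₂ - 2)| * c₂ := by linarith
      have hpos : 0 < 1 - |lam * (lam - 2) - lam₂ * (lam₂ - 2)| * c₂ := by linarith
      apply mul_le_mul_of_nonneg_right _ (Real.exp_pos _).le
      apply mul_le_mul_of_nonneg_right _ (by positivity)
      exact div_le_div_of_nonneg_left hc₂ (by norm_num) hden
    rw [Real.norm_eq_abs, abs_mul, abs_mul, abs_pow, sq_abs]
    have h0 : 0 ≤ |lam - lam₂| * (lam + lam₂ - 2) ^ 2 := by positivity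
    exact mul_le_mul_of_nonneg_left hRK h0
  simpa using hA.add hB

include hlam₂ hε₂ hε₄ hg hN0 hN in
/-- The resolvent is continuous in the spectral parameter. -/
theorem continuousAt_greenSolI_lam {t : ℝ} (ht : 0 < t) :
    ContinuousAt (fun lam => greenSolI (fun t => sph lam (hyp t)) (sphDecay lam) g t) lam₂ :=
  (hasDerivAt_greenSolI_lam hlam₂ hε₂ hε₄ hg hN0 hN ht).continuousAt

end derivative

end Summit.Ventures.HodgeRepro2.T5SU11ResolventAnalytic
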